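import Mathlib
import Summits.Ventures.PercRepro2.Defs
import Summits.Ventures.PercRepro2.Independence
import Summits.Ventures.PercRepro2.Harris
import Summits.Ventures.PercRepro2.Graph
import Summits.Ventures.PercRepro2.Exploration
import Summits.Ventures.PercRepro2.GriffithsOne
import Summits.Ventures.PercRepro2.PartDefs
import Summits.Ventures.PercRepro2.PartFactor
import Summits.Ventures.PercRepro2.PartGriffiths

/-!
# THE CORE-FREE UNION THEOREM (PART) (blind cell PercRepro2, typer-1; mine-1 g9
`proofs/MINE1-IID-UNION.md` §2, conjectures/MINE-1.md (PU-V) at `w ≡ 0`; lead g11 13:37:16Z)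

**Two independent clusters of the root `l` that partition `V ∖ {l}` put two vertices `x, y` on the
same side more often than on opposite sides**: for every finite (multi)graph, every root `l`,
every pair `x, y ≠ l` and every admissible weight vector,

`Σ_{S ⊆ V ∖ {l}} P(C(l) = S ∪ {l}) · P(C(l) = V ∖ S) · σ_x(S) σ_y(S) ≥ 0`, `σ_v(S) = ±1` as `v ∈ S` or not

(`part_nonneg`, the partition `S` encoded as `τ : V → Bool` with `τ l = false`, `S = {τ = true}`;
`part_nonneg'` states it with the sets written out). The two factors are the SAME cluster law
evaluated at complementary sets — mine-1's "two independent copies" `C, C′` of the cluster of `l`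
conditioned on `C ∩ C′ = {l}`, `C ∪ C′ = V`, i.e. `E[σ_x σ_y ; C ∩ C′ = {l}, C ∪ C′ = V] ≥ 0` with
`σ_v = 1[v ∈ C] − 1[v ∈ C′]`.

Proof (mine-1's η-factorisation, without branches): `P(C = S ∪ l) P(C = V ∖ S) = Π_{root}(1 − p) ·
Π_{cross(S)}(1 − p) · P(η spans, cross(S) closed)` (`prob_clusterEvent_mul_eq`); summing over `S`
and exchanging with the sum over `η`, the inner sum is an Ising sum
`Σ_S σ_x σ_y Π_e (α_e(η) + β_e(η) σ_{u_e} σ_{v_e})` with ferromagnetic couplings (infinite on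
`η`-open edges, `q_e = 1 − p_e` on `η`-closed ones), nonnegative by Griffiths' first inequality
(`inner_nonneg`, `Griffiths.griffiths_one`).
-/

namespace Summit.Ventures.PercRepro2

namespace Part

open Griffiths

open scoped Classical

variable {V : Type*} {E : Type*} [Fintype V] [DecidableEq V] [Fintype E] [DecidableEq E]
  {R : Type*} [Field R] [LinearOrder R] [IsStrictOrderedRing R]

variable (p : E → R) (ends : E → Sym2 V) (l : V)

omit [Fintype V] [DecidableEq V] [LinearOrder R] [IsStrictOrderedRing R] in
/-- `P(A ∩ B) = Σ_η w(η) · 1_A(η) · 1_B(η)`. -/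
lemma prob_inter_eq_sum_weight (A B : Set (Config E)) :
    prob p (A ∩ B) = ∑ η, weight p η * (A.indicator 1 η * B.indicator 1 η) := by
  unfold prob
  refine Finset.sum_congr rfl fun η _ => ?_
  rw [← indicator_inter_one]
  by_cases h : η ∈ A ∩ B
  · rw [Set.indicator_of_mem h, Set.indicator_of_mem h]; simp
  · rw [Set.indicator_of_notMem h, Set.indicator_of_notMem h]; simp

omit [Fintype V] [DecidableEq V] in
/-- The summand of (PART) for one partition `τ`, expanded over the configurations `η`:
`[τ l = false] P(C = W₁) P(C = W₂) σ_x σ_y = Σ_η c_root · w(η) 1_span(η) · [τ l = false] · (Ising term)`. -/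
lemma term_eq (x y : V) (τ : V → Bool) :
    (if τ l = false then
        prob p (clusterEvent ends l (sideSet l τ true)) *
          prob p (clusterEvent ends l (sideSet l τ false)) * (spin (τ x) * spin (τ y))
      else 0) =
      ∑ η, (∏ e, if rootEdge ends l e then 1 - p e else 1) *
        (weight p η * (spanning ends l).indicator 1 η) *
          (if τ l = false then isingTerm ends l p η x y τ else 0) := by
  by_cases hl : τ l = false
  · rw [if_pos hl, prob_clusterEvent_mul_eq p ends l hl, prob_inter_eq_sum_weight, Finset.mul_sum,
      Finset.sum_mul]
    refine Finset.sum_congr rfl fun η _ => ?_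
    rw [if_pos hl]
    unfold isingTerm
    rw [← cross_factor_eq]
    ring
  · rw [if_neg hl]
    simp only [if_neg hl, mul_zero, Finset.sum_const_zero]

/-- **(PART), the core-free union theorem**: for `x, y ≠ l`,
`0 ≤ Σ_{τ : V → Bool, τ l = false} P(C(l) = {τ = true} ∪ {l}) · P(C(l) = {τ = false}) · σ_x(τ) σ_y(τ)`
(`sideSet l τ true = {τ = true} ∪ {l}`, `sideSet l τ false = {τ = false}`, `σ = spin ∘ τ`). -/
theorem part_nonneg (hp : IsProbVec p) {x y : V} (hx : x ≠ l) (hy : y ≠ l) :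
    0 ≤ ∑ τ : V → Bool, if τ l = false then
      prob p (clusterEvent ends l (sideSet l τ true)) *
        prob p (clusterEvent ends l (sideSet l τ false)) * (spin (τ x) * spin (τ y))
      else 0 := by
  rw [Finset.sum_congr rfl fun τ _ => term_eq p ends l x y τ, Finset.sum_comm]
  refine Finset.sum_nonneg fun η _ => ?_
  rw [← Finset.mul_sum]
  have hroot : 0 ≤ ∏ e, if rootEdge ends l e then 1 - p e else 1 := by
    refine Finset.prod_nonneg fun e _ => ?_
    split_ifs
    · have := hp.le_one e; linarith
    · exact zero_le_one
  exact mul_nonneg (mul_nonneg hroot (mul_nonneg (weight_nonneg hp η)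
    (Set.indicator_apply_nonneg fun _ => zero_le_one)))
    (inner_nonneg (ends := ends) (l := l) hp η hx hy)

/-- **(PART)** with the two sets written out: for `x, y ≠ l`,
`0 ≤ Σ_{τ l = false} P(C(l) = {τ = true} ∪ {l}) · P(C(l) = {τ = false}) · σ_x(τ) σ_y(τ)`. -/
theorem part_nonneg' (hp : IsProbVec p) {x y : V} (hx : x ≠ l) (hy : y ≠ l) :
    0 ≤ ∑ τ : V → Bool, if τ l = false then
      prob p (clusterEvent ends l ({v | τ v = true} ∪ {l})) *
        prob p (clusterEvent ends l {v | τ v = false}) * (spin (τ x) * spin (τ y))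
      else 0 := by
  refine le_of_le_of_eq (part_nonneg p ends l hp hx hy) (Finset.sum_congr rfl fun τ _ => ?_)
  by_cases hl : τ l = false
  · rw [if_pos hl, if_pos hl, sideSet_true_eq, sideSet_false_eq hl]
  · rw [if_neg hl, if_neg hl]

/-- The indicator colouring of a finset: `τ_S v = true ↔ v ∈ S`. -/
def colouring (S : Finset V) : V → Bool := fun v => decide (v ∈ S)

/-- **(PART) in the paper's form**: for `x, y ≠ l`,
`0 ≤ Σ_{S ⊆ V ∖ {l}} P(C(l) = S ∪ {l}) · P(C(l) = V ∖ S) · σ_x(S) σ_y(S)`, `σ_v(S) = +1` if `v ∈ S`,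
`−1` otherwise. -/
theorem part_nonneg_finset (hp : IsProbVec p) {x y : V} (hx : x ≠ l) (hy : y ≠ l) :
    0 ≤ ∑ S ∈ (Finset.univ.erase l).powerset,
      prob p (clusterEvent ends l (↑S ∪ {l})) * prob p (clusterEvent ends l (↑S)ᶜ) *
        (spin (decide (x ∈ S)) * spin (decide (y ∈ S))) := by
  refine le_of_le_of_eq (part_nonneg' p ends l hp hx hy) ?_
  rw [← Finset.sum_filter]
  symm
  refine Finset.sum_nbij' colouring (fun τ => Finset.univ.filter fun v => τ v = true)
    (fun S hS => ?_) (fun τ hτ => ?_) (fun S hS => ?_) (fun τ hτ => ?_) (fun S hS => ?_)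
  · -- the colouring of `S ⊆ V ∖ {l}` has `τ l = false`
    rw [Finset.mem_powerset] at hS
    rw [Finset.mem_filter]
    refine ⟨Finset.mem_univ _, ?_⟩
    simp only [colouring, decide_eq_false_iff_not]
    intro h
    exact (Finset.mem_erase.1 (hS h)).1 rfl
  · -- the filter of a colouring with `τ l = false` avoids `l`
    rw [Finset.mem_filter] at hτ
    rw [Finset.mem_powerset]
    intro v hv
    rw [Finset.mem_filter] at hv
    rw [Finset.mem_erase]
    refine ⟨fun h => ?_, Finset.mem_univ v⟩
    subst h
    rw [hτ.2] at hv
    exact Bool.false_ne_true hv.2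
  · -- `filter ∘ colouring = id`
    ext v
    simp [colouring]
  · -- `colouring ∘ filter = id`
    funext v
    simp [colouring]
  · -- the summands agree
    have h1 : ({v | colouring S v = true} : Set V) = ↑S := by ext v; simp [colouring]
    have h2 : ({v | colouring S v = false} : Set V) = (↑S)ᶜ := by ext v; simp [colouring]
    rw [h1, h2]
    rfl

end Part

end Summit.Ventures.PercRepro2
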